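import Mathlib
import Summits.Ventures.HodgeRepro2.T5MuInvariantDVR
import Summits.Ventures.HodgeRepro2.T5MuInvariantPadicCosets

/-!
# T5MeasureDistribution — a W-valued measure on ℤ_p as a finitely additive function on the open
cosets: the element of lim_k W[ℤ/p^k] = W[[ℤ_p]] attached to a bounded functional

Tier-5 support for route-3's §G (route/T5-CHECK-G-p7.md §3 S1 / S4 / S5, §20.2 «what stays prose:
that the Katz branch measure is such an m»): in print the Katz measure is an element of the
completed group ring W[[Γ]] = lim_k W[Γ/Γ^{p^k}], i.e. a compatible system of values on the open
cosets of Γ ≅ ℤ_p, and Hsieh's / Burungale–Hida's μ-invariant is «inf_U v_p(φ(U))» over those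
cosets; the kernel model of this record (§55–§87) takes a measure to be a bounded linear
functional on C(ℤ_p, W).  This file gives the dictionary from the model to the print:

* `resClass k a` = the residue class a + p^k ℤ_p (the fibre of `PadicInt.toZModPow k`), clopen, a
  disjoint union of the classes of the next level (`indicatorCM_resClass_eq_sum`);
* `dist m k a := m(1_{a + p^k ℤ_p})` — the values of the measure on the open cosets; they are
  COMPATIBLE (`dist_compat`: φ(a + p^kℤ_p) = Σ_{b ≡ a} φ(b + p^{k+1}ℤ_p), the inverse-limit
  condition) and BOUNDED (`norm_dist_le`), so `toDistribution m : Distribution p A` is an element of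
  lim_k A[ℤ/p^k] in the sense of the structure `Distribution` (value function + compatibility +
  bound);
* `eq_of_dist_eq` / `toDistribution_injective` — a bounded measure IS its distribution (determined
  by its values on the open cosets: every clopen set is a finite disjoint union of residue classes,
  `indicatorCM_eq_sum_resClass`, and §59's determination by clopen indicators);
* `muV_eq_iInf_dist` / `muV_eq_iInf_coset` — the μ-invariant of T5MuInvariantDVR is literally the
  print's «inf over the open cosets a + p^kℤ_p of v(φ(U))», for W-valued measures (the A-valued
  form of §81's `mu_eq_iInf_coset`).

GAP (stated, not claimed): the converse — that every bounded compatible system comes from a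
bounded functional (the classical construction by Riemann sums over the residue classes) — is
not in this file; `toDistribution` is proved injective, not surjective.

No printed input is consumed.  §8(d): uses an L-value-free non-vanishing device: NO.
-/

namespace Summit.Ventures.HodgeRepro2.T5MeasureDistribution

open Summit.Ventures.HodgeRepro2.T5MeasureSupOnClopens (indicatorCM indicatorCM_apply
  norm_indicatorCM_le)
open Summit.Ventures.HodgeRepro2.T5MuInvariantPadicCosets (coset isClopen_coset
  mem_coset_iff_toZModPow exists_forall_coset_subset self_mem_coset)
open Summit.Ventures.HodgeRepro2.T5MuInvariantDVR
open IsDiscreteValuationRing (addVal)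
open Finset

variable {p : ℕ} [Fact (Nat.Prime p)]

section ResClass

/-- The residue class `a + p^k ℤ_p`: the fibre of `PadicInt.toZModPow k` over `a : ℤ/p^k`. -/
def resClass (k : ℕ) (a : ZMod (p ^ k)) : Set ℤ_[p] := {x | PadicInt.toZModPow k x = a}

/-- `x ∈ resClass k a ↔ toZModPow k x = a`. -/
theorem mem_resClass_iff {k : ℕ} {a : ZMod (p ^ k)} {x : ℤ_[p]} :
    x ∈ resClass k a ↔ PadicInt.toZModPow k x = a := Iff.rfl

/-- The residue class of `b` is §81's coset `b + p^k ℤ_p`. -/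
theorem resClass_toZModPow_eq_coset (k : ℕ) (b : ℤ_[p]) :
    resClass k (PadicInt.toZModPow k b) = coset b k := by
  ext x
  rw [mem_resClass_iff, mem_coset_iff_toZModPow]

/-- `coset b k = resClass k (toZModPow k b)`. -/
theorem coset_eq_resClass (b : ℤ_[p]) (k : ℕ) :
    coset b k = resClass k (PadicInt.toZModPow k b) :=
  (resClass_toZModPow_eq_coset k b).symm

/-- Every residue class is a coset (`toZModPow k` is onto). -/
theorem exists_resClass_eq_coset (k : ℕ) (a : ZMod (p ^ k)) : ∃ b : ℤ_[p], resClass k a = coset b k := by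
  obtain ⟨b, rfl⟩ := ZMod.ringHom_surjective (PadicInt.toZModPow k) a
  exact ⟨b, resClass_toZModPow_eq_coset k b⟩

/-- Residue classes are clopen. -/
theorem isClopen_resClass (k : ℕ) (a : ZMod (p ^ k)) : IsClopen (resClass k a) := by
  obtain ⟨b, hb⟩ := exists_resClass_eq_coset k a
  rw [hb]
  exact isClopen_coset b k

/-- `x ∈ resClass k a` iff `x`'s own class at level `k` is `resClass k a`. -/
theorem resClass_toZModPow_self (k : ℕ) (x : ℤ_[p]) : x ∈ resClass k (PadicInt.toZModPow k x) := rfl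

variable {A : Type*} [NormedCommRing A]

/-- `x` lies in exactly one residue class of each level. -/
theorem indicator_resClass_of_ne {k : ℕ} {b : ZMod (p ^ k)} {x : ℤ_[p]}
    (h : PadicInt.toZModPow k x ≠ b) (f : ℤ_[p] → A) : (resClass k b).indicator f x = 0 :=
  Set.indicator_of_notMem (show x ∉ resClass k b from h) f

/-- Pointwise form of the next-level decomposition of a residue class. -/
theorem indicator_resClass_eq_sum_succ (k : ℕ) (a : ZMod (p ^ k)) (x : ℤ_[p]) :
    (resClass k a).indicator (1 : ℤ_[p] → A) x =
      ∑ b ∈ univ.filter (fun b : ZMod (p ^ (k + 1)) => (b.cast : ZMod (p ^ k)) = a),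
        (resClass (k + 1) b).indicator (1 : ℤ_[p] → A) x := by
  have hcast : ((PadicInt.toZModPow (k + 1) x).cast : ZMod (p ^ k)) = PadicInt.toZModPow k x :=
    PadicInt.cast_toZModPow k (k + 1) (Nat.le_succ k) x
  by_cases h : PadicInt.toZModPow k x = a
  · rw [Set.indicator_of_mem (show x ∈ resClass k a from h),
      Finset.sum_eq_single_of_mem (PadicInt.toZModPow (k + 1) x)
        (Finset.mem_filter.2 ⟨Finset.mem_univ _, hcast.trans h⟩)
        (fun b _ hb => indicator_resClass_of_ne (Ne.symm hb) _),
      Set.indicator_of_mem (resClass_toZModPow_self (k + 1) x)]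
  · rw [Set.indicator_of_notMem (show x ∉ resClass k a from h)]
    refine (Finset.sum_eq_zero fun b hb => ?_).symm
    refine indicator_resClass_of_ne (fun hxb => h ?_) _
    rw [← hcast, hxb]
    exact (Finset.mem_filter.1 hb).2

/-- The indicator of a residue class at level `k` is the sum of the indicators of the classes at
level `k + 1` lying over it (a finite DISJOINT union — the inverse-limit shape). -/
theorem indicatorCM_resClass_eq_sum (k : ℕ) (a : ZMod (p ^ k)) :
    (indicatorCM (resClass k a) : C(ℤ_[p], A)) =
      ∑ b ∈ univ.filter (fun b : ZMod (p ^ (k + 1)) => (b.cast : ZMod (p ^ k)) = a),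
        indicatorCM (resClass (k + 1) b) := by
  ext x
  simp only [ContinuousMap.coe_sum, Finset.sum_apply, indicatorCM_apply (isClopen_resClass _ _)]
  exact indicator_resClass_eq_sum_succ k a x

open Classical in
/-- Pointwise form of the decomposition of a clopen set into the residue classes of level `K` it
contains, `K` as in §81's `exists_forall_coset_subset`. -/
theorem indicator_eq_sum_resClass_of_forall {U : Set ℤ_[p]} {K : ℕ}
    (hK : ∀ x ∈ U, coset x K ⊆ U) (x : ℤ_[p]) :
    U.indicator (1 : ℤ_[p] → A) x =
      ∑ a ∈ univ.filter (fun a : ZMod (p ^ K) => resClass K a ⊆ U),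
        (resClass K a).indicator (1 : ℤ_[p] → A) x := by
  by_cases hx : x ∈ U
  · have hmem : resClass K (PadicInt.toZModPow K x) ⊆ U := by
      rw [resClass_toZModPow_eq_coset]
      exact hK x hx
    rw [Set.indicator_of_mem hx,
      Finset.sum_eq_single_of_mem (PadicInt.toZModPow K x)
        (Finset.mem_filter.2 ⟨Finset.mem_univ _, hmem⟩)
        (fun b _ hb => indicator_resClass_of_ne (Ne.symm hb) _),
      Set.indicator_of_mem (resClass_toZModPow_self K x)]
  · rw [Set.indicator_of_notMem hx]
    refine (Finset.sum_eq_zero fun a ha => ?_).symm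
    refine indicator_resClass_of_ne (fun hxa => hx ?_) _
    have hsub : resClass K a ⊆ U := (Finset.mem_filter.1 ha).2
    exact hsub (hxa ▸ resClass_toZModPow_self K x)

open Classical in
/-- Every clopen subset of ℤ_p is a finite disjoint union of residue classes of one level `K`:
its indicator is the sum of the indicators of the classes it contains (§81's
`exists_forall_coset_subset`). -/
theorem indicatorCM_eq_sum_resClass {U : Set ℤ_[p]} (hU : IsClopen U) :
    ∃ K : ℕ, (indicatorCM U : C(ℤ_[p], A)) =
      ∑ a ∈ univ.filter (fun a : ZMod (p ^ K) => resClass K a ⊆ U), indicatorCM (resClass K a) := by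
  obtain ⟨K, hK⟩ := exists_forall_coset_subset hU
  refine ⟨K, ?_⟩
  ext x
  simp only [ContinuousMap.coe_sum, Finset.sum_apply, indicatorCM_apply hU,
    indicatorCM_apply (isClopen_resClass _ _)]
  exact indicator_eq_sum_resClass_of_forall hK x

end ResClass

section Dist

variable {A : Type*} [NormedCommRing A]

/-- The values of a measure on the open cosets: `dist m k a := m(1_{a + p^k ℤ_p})` — the
coordinates of `m` as an element of lim_k A[ℤ/p^k]. -/
noncomputable def dist (m : C(ℤ_[p], A) →ₗ[A] A) (k : ℕ) (a : ZMod (p ^ k)) : A :=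
  m (indicatorCM (resClass k a))

/-- `dist m k a = m(1_{resClass k a})`. -/
theorem dist_apply (m : C(ℤ_[p], A) →ₗ[A] A) (k : ℕ) (a : ZMod (p ^ k)) :
    dist m k a = m (indicatorCM (resClass k a)) := rfl

/-- The value on a coset `b + p^k ℤ_p` is `dist m k (b mod p^k)`. -/
theorem map_indicatorCM_coset (m : C(ℤ_[p], A) →ₗ[A] A) (b : ℤ_[p]) (k : ℕ) :
    m (indicatorCM (coset b k)) = dist m k (PadicInt.toZModPow k b) := by
  rw [dist_apply, resClass_toZModPow_eq_coset]

/-- COMPATIBILITY (the inverse-limit condition): the value on a class at level `k` is the sum of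
the values on the classes at level `k + 1` over it — finite additivity of the measure. -/
theorem dist_compat (m : C(ℤ_[p], A) →ₗ[A] A) (k : ℕ) (a : ZMod (p ^ k)) :
    dist m k a = ∑ b ∈ univ.filter (fun b : ZMod (p ^ (k + 1)) => (b.cast : ZMod (p ^ k)) = a),
      dist m (k + 1) b := by
  simp only [dist_apply]
  rw [indicatorCM_resClass_eq_sum, map_sum]

/-- BOUNDEDNESS: `‖dist m k a‖ ≤ C` for a measure bounded by `C` (indicators have norm `≤ 1`). -/
theorem norm_dist_le [NormOneClass A] (m : C(ℤ_[p], A) →ₗ[A] A) {C : ℝ} (hC : 0 ≤ C)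
    (hm : ∀ φ : C(ℤ_[p], A), ‖m φ‖ ≤ C * ‖φ‖) (k : ℕ) (a : ZMod (p ^ k)) : ‖dist m k a‖ ≤ C :=
  (hm _).trans (mul_le_of_le_one_right hC (norm_indicatorCM_le _))

/-- A bounded `A`-valued DISTRIBUTION on ℤ_p: a compatible system of values on the residue
classes of every level with a uniform bound — an element of lim_k A[ℤ/p^k] = A[[ℤ_p]] in the
print's sense (Katz: a measure IS such a system; Hsieh: `m ∈ W[[Γ_𝔭]]`). -/
structure Distribution (p : ℕ) [Fact (Nat.Prime p)] (A : Type*) [NormedCommRing A] where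
  /-- the value on the class `a + p^k ℤ_p`. -/
  val : ∀ k : ℕ, ZMod (p ^ k) → A
  /-- the inverse-limit condition. -/
  compat : ∀ (k : ℕ) (a : ZMod (p ^ k)),
    val k a = ∑ b ∈ univ.filter (fun b : ZMod (p ^ (k + 1)) => (b.cast : ZMod (p ^ k)) = a), val (k + 1) b
  /-- a uniform bound. -/
  bound : ℝ
  /-- `‖val k a‖ ≤ bound`. -/
  norm_le : ∀ (k : ℕ) (a : ZMod (p ^ k)), ‖val k a‖ ≤ bound

/-- The distribution of a bounded measure. -/
noncomputable def toDistribution [NormOneClass A] (m : C(ℤ_[p], A) →ₗ[A] A) {C : ℝ} (hC : 0 ≤ C)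
    (hm : ∀ φ : C(ℤ_[p], A), ‖m φ‖ ≤ C * ‖φ‖) : Distribution p A where
  val := dist m
  compat := dist_compat m
  bound := C
  norm_le := norm_dist_le m hC hm

/-- `(toDistribution m hC hm).val = dist m`. -/
@[simp] theorem toDistribution_val [NormOneClass A] (m : C(ℤ_[p], A) →ₗ[A] A) {C : ℝ} (hC : 0 ≤ C)
    (hm : ∀ φ : C(ℤ_[p], A), ‖m φ‖ ≤ C * ‖φ‖) : (toDistribution m hC hm).val = dist m := rfl

/-- A BOUNDED MEASURE IS ITS DISTRIBUTION: two bounded functionals with the same values on all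
residue classes coincide (every clopen indicator is a finite sum of class indicators, and §59's
`eq_of_forall_indicator`). -/
theorem eq_of_dist_eq (m₁ m₂ : C(ℤ_[p], A) →ₗ[A] A) {C : ℝ} (hC : 0 ≤ C)
    (hm₁ : ∀ φ : C(ℤ_[p], A), ‖m₁ φ‖ ≤ C * ‖φ‖) (hm₂ : ∀ φ : C(ℤ_[p], A), ‖m₂ φ‖ ≤ C * ‖φ‖)
    (h : ∀ (k : ℕ) (a : ZMod (p ^ k)), dist m₁ k a = dist m₂ k a) : m₁ = m₂ := by
  apply T5LocallyConstantDetermines.eq_of_forall_indicator m₁ m₂ hC hm₁ hm₂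
  intro U hU
  obtain ⟨K, hK⟩ := indicatorCM_eq_sum_resClass (A := A) hU
  rw [hK, map_sum, map_sum]
  exact Finset.sum_congr rfl fun a _ => h K a

/-- `toDistribution` is injective on measures bounded by a common `C`. -/
theorem toDistribution_injective [NormOneClass A] (m₁ m₂ : C(ℤ_[p], A) →ₗ[A] A) {C : ℝ}
    (hC : 0 ≤ C) (hm₁ : ∀ φ : C(ℤ_[p], A), ‖m₁ φ‖ ≤ C * ‖φ‖)
    (hm₂ : ∀ φ : C(ℤ_[p], A), ‖m₂ φ‖ ≤ C * ‖φ‖)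
    (h : toDistribution m₁ hC hm₁ = toDistribution m₂ hC hm₂) : m₁ = m₂ :=
  eq_of_dist_eq m₁ m₂ hC hm₁ hm₂ fun k a => by
    have := congrArg Distribution.val h
    exact congrFun (congrFun this k) a

/-- A measure vanishing on every residue class is zero. -/
theorem eq_zero_of_forall_dist_eq_zero (m : C(ℤ_[p], A) →ₗ[A] A) {C : ℝ} (hC : 0 ≤ C)
    (hm : ∀ φ : C(ℤ_[p], A), ‖m φ‖ ≤ C * ‖φ‖)
    (h : ∀ (k : ℕ) (a : ZMod (p ^ k)), dist m k a = 0) : m = 0 :=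
  eq_of_dist_eq m 0 hC hm
    (fun φ => by
      simp only [LinearMap.zero_apply, norm_zero]
      exact mul_nonneg hC (norm_nonneg φ))
    (fun k a => by rw [h k a, dist_apply, LinearMap.zero_apply])

end Dist

section Mu

variable {A : Type*} [NormedCommRing A] [IsDomain A] [IsDiscreteValuationRing A]

/-- THE μ-INVARIANT AS PRINTED: «μ(φ) = inf over the open cosets U = a + p^k ℤ_p of v(φ(U))» —
`muV m = ⨅ k a, v(dist m k a)` (the residue classes are clopen, and every clopen indicator is a
finite sum of class indicators, with `v(Σ) ≥ min v` by the ultrametric property of `addVal`). -/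
theorem muV_eq_iInf_dist (m : C(ℤ_[p], A) →ₗ[A] A) :
    muV m = ⨅ k : ℕ, ⨅ a : ZMod (p ^ k), addVal A (dist m k a) := by
  apply le_antisymm
  · exact le_iInf fun k => le_iInf fun a => muV_le m (isClopen_resClass k a)
  · unfold muV
    refine le_iInf fun U => ?_
    obtain ⟨K, hK⟩ := indicatorCM_eq_sum_resClass (A := A) U.2
    rw [hK, map_sum]
    exact AddValuation.map_le_sum _ fun a _ =>
      (iInf_le (fun k : ℕ => ⨅ a : ZMod (p ^ k), addVal A (dist m k a)) K).trans
        (iInf_le (fun a : ZMod (p ^ K) => addVal A (dist m K a)) a)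

/-- The same in §81's coset vocabulary: `muV m = ⨅ k, ⨅ b : ℤ_p, v(m(1_{b + p^k ℤ_p}))` — the
`A`-valued form of `mu_eq_iInf_coset`. -/
theorem muV_eq_iInf_coset (m : C(ℤ_[p], A) →ₗ[A] A) :
    muV m = ⨅ k : ℕ, ⨅ b : ℤ_[p], addVal A (m (indicatorCM (coset b k))) := by
  rw [muV_eq_iInf_dist]
  apply le_antisymm
  · refine le_iInf fun k => le_iInf fun b => ?_
    rw [map_indicatorCM_coset]
    exact (iInf_le (fun k : ℕ => ⨅ a : ZMod (p ^ k), addVal A (dist m k a)) k).trans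
      (iInf_le (fun a : ZMod (p ^ k) => addVal A (dist m k a)) _)
  · refine le_iInf fun k => le_iInf fun a => ?_
    obtain ⟨b, hb⟩ := exists_resClass_eq_coset k a
    rw [dist_apply, hb]
    exact (iInf_le (fun k : ℕ => ⨅ b : ℤ_[p], addVal A (m (indicatorCM (coset b k)))) k).trans
      (iInf_le (fun b : ℤ_[p] => addVal A (m (indicatorCM (coset b k)))) b)

/-- `n ≤ μ(m)` iff `p^n`-divisibility (valuation `≥ n`) of every value on the open cosets. -/
theorem natCast_le_muV_iff_forall_dist (m : C(ℤ_[p], A) →ₗ[A] A) (n : ℕ) :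
    (n : ℕ∞) ≤ muV m ↔ ∀ (k : ℕ) (a : ZMod (p ^ k)), (n : ℕ∞) ≤ addVal A (dist m k a) := by
  rw [muV_eq_iInf_dist]
  simp only [le_iInf_iff]

end Mu

end Summit.Ventures.HodgeRepro2.T5MeasureDistribution
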